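import Summits.BirchSwinnertonDyer.BirchSwinnertonDyer.Theorems.SignedBaseChangeAnticyclotomicEisensteinDivisibilityAdmdefRamifiedNS
import HarnessLib

/-!
# Line `admdef` on the crux `AnticyclotomicEisensteinDivisibility` (stmt-BirchSwinnertonDyer-20727), LEAD gen 24:
# C⁺⁺_NS WITH THE DISCRIMINANT BINDERS (`D_K` odd, `D_K ≠ −3`) ⟹ S1 on the non-square-free all-ramified cell

Lead seat bsd-line-sbc-p1 (gen 24), `--supports stmt-BirchSwinnertonDyer-20727`.  The v15 glue
`SignedBaseChangeAcDivAdmdefRamifiedNS.bdpLowerHalfRatSS_ramifiedNS_of_chkllPlusRatNS` (p724409) consumes the research text C⁺⁺_NS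
(`AdmdefLine.CHKLLPlusRatNS`) WITHOUT the crux binders `Odd (NumberField.discr K)`, `NumberField.discr K ≠ -3`, although S1 carries
them.  The v22 re-key of the core-root stub (Heegner/primitive currency) reaches the `μ = 0` BDP frame of the cite conjunct (7)
(Burungale–Castella–Skinner 2025 Prop. 4.2.2, typed with (disc)) at the [NV] consumer, so the two binders must be THREADED through
C⁺⁺_NS.  THIS FILE is the same glue with the hypothesis `hC` = the body of `AdmdefLine.CHKLLPlusRatNSDisc` (C⁺⁺_NS with the two
binders inserted after `¬ p ∣ h_K`); the proof is p724409's VERBATIM with `hodd hne3` passed into `hC` (frame concordance p634869,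
`J/J₀` rigidity, push along `R₀ → 𝒪_{ℂ_p}`).  `hC` is WEAKER than the v15 hypothesis (more binders), so this theorem is STRONGER
than p724409 as an implication.  No definition, no named fact, no `sorry`; standard axioms.  BSD / the crux / C⁺⁺_NS NOT proved here.
[cite: CastellaEtAl2025, Thm. 7.1 / Cor. 7.2 (arXiv:2308.10474v2 §7)] [cite: Castella2018, Thm. 3.1] [cite: CastellaWan2023, Prop. 2.1]
-/

-- D-0017: single-problem summit, the namespace repeats the problem name by design.
set_option linter.dupNamespace false
set_option autoImplicit false

noncomputable section

open scoped Classical NumberField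

open NumberField IsDedekindDomain Field
  Literature.NumberTheory.EllipticCurves Literature.NumberTheory.EllipticCurves.ModularForms
  Literature.NumberTheory.EllipticCurves.Rank1Residual Literature.NumberTheory.EllipticCurves.Castella2018
  Literature.NumberTheory.EllipticCurves.CastellaWan2024 Literature.NumberTheory.GaloisRepresentations
  Literature.NumberTheory.EllipticCurves.YanZhu2026
  Summit.BirchSwinnertonDyer.Rank1Residual.X11b Summit.BirchSwinnertonDyer.Rank1Residual.X11b.Halves
  Summit.BirchSwinnertonDyer.BirchSwinnertonDyer.Theorems

namespace Summit.BirchSwinnertonDyer.BirchSwinnertonDyer.Theorems.SignedBaseChangeAcDivAdmdefRamifiedNSDisc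

open Summit.BirchSwinnertonDyer.BirchSwinnertonDyer.Theses.SignedBaseChange

/-- **C⁺⁺_NS (with the discriminant binders) ⟹ S1 on the NON-SQUARE-FREE ALL-RAMIFIED cell at `p ∤ h_K` (PROVED).**  The registered
S1 text with the three binders `¬ p ∣ NumberField.classNumber K →`, `¬ Squarefree N →` and "every `q ∣ N` has an inertia element moving a
`p`-torsion point" inserted after `κ₂.IsAnticyclotomic →`, from the hypothesis `hC` = C⁺⁺_NS carrying ALSO `Odd (NumberField.discr K) →
NumberField.discr K ≠ -3 →` (the body of `AdmdefLine.CHKLLPlusRatNSDisc`, v22).  Proof = p724409 verbatim with `hodd hne3` passed into `hC`.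
[cite: CastellaEtAl2025, Thm. 7.1 / Cor. 7.2] [cite: Castella2018, Thm. 3.1] [cite: CastellaWan2023, Prop. 2.1 (MS p. 6)] -/
theorem bdpLowerHalfRatSS_ramifiedNS_of_chkllPlusRatNSDisc (hC : (∀ {p : ℕ} [Fact p.Prime] (ι : PadicAlgCl p ≃+* ℂ) (W : WeierstrassCurve ℚ) [W.IsElliptic]
    [W.IsGloballyMinimal] (K : Type) [Field K] [NumberField K]
    (𝔭 𝔭bar : HeightOneSpectrum (𝓞 K)) (κ : ZpExtension K p) (γ : absoluteGaloisGroup K)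
    [Fact (κ.IsTopGenerator γ)] {N : ℕ} [NeZero N] {f : CuspForm (CongruenceSubgroup.Gamma0 N) 2}
    (_ : IsNewformOf W f),
    (N : ℤ) = W.conductorNorm ℤ → 5 ≤ p → W.HasGoodReductionAtPrime p → W.frobeniusTrace p = 0 →
    Surj W p →
    IsImaginaryQuadratic K → ((Ideal.span {(p : ℤ)}).primesOver (𝓞 K)).ncard = 2 →
      ((p : ℕ) : 𝓞 K) ∈ 𝔭.asIdeal →
      (∀ (w : InfinitePlace K) (k : 𝓞 K), k ∈ 𝔭.asIdeal ↔ ‖ι.symm (w.embedding (k : K))‖ < 1) →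
      ((p : ℕ) : 𝓞 K) ∈ 𝔭bar.asIdeal → 𝔭bar ≠ 𝔭 →
    (∀ ℓ : ℕ, ℓ.Prime → ℓ ∣ N → ((Ideal.span {(ℓ : ℤ)}).primesOver (𝓞 K)).ncard = 2) →
    IsCoprime (N : ℤ) (NumberField.discr K) → ¬ p ∣ NumberField.classNumber K →
    -- [v22] the discriminant binders of the crux, THREADED (needed to reach the `μ = 0` frame of cite conjunct (7))
    Odd (NumberField.discr K) → NumberField.discr K ≠ -3 →
    -- (i) NEGATED: `N` is NOT square-free (the square-free case is the printed theorem, conjunct 8 of the cite stub)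
    ¬ Squarefree N →
    -- (ii): `E[p]` ramified at every prime `q ∣ N`
    (∀ q : ℕ, q.Prime → q ∣ N →
      ∃ v : HeightOneSpectrum (𝓞 ℚ), ((q : ℕ) : 𝓞 ℚ) ∈ v.asIdeal ∧
        ∃ 𝔓 ∈ v.primesAbove, ∃ σ ∈ 𝔓.inertia (absoluteGaloisGroup ℚ),
          ∃ P : W.geomTorsion (p : ℤ), σ • P ≠ P) →
    κ.IsAnticyclotomic →
    ∃ (ΩK : ℂ) (Ωp : (unrIntegers p)ˣ) (L : UnrSeries p),
      ΩK ≠ 0 ∧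
      IsCWBDPLFunction ι 𝔭 κ γ f (NumberField.discr K) ΩK ((Ωp : unrIntegers p) : ℂ_[p]) L ∧
      ∀ (j : ℤ_[p] →+* unrIntegers p),
        (∀ x : ℤ_[p], ((j x : unrIntegers p) : ℂ_[p]) = algebraMap ℚ_[p] ℂ_[p] (x : ℚ_[p])) →
        ∃ k : ℕ,
          Ideal.span {PowerSeries.C ((p : unrIntegers p) ^ k)} *
              (Castella2018.AcSelmer.XAc.charIdeal (W.baseChange K) p κ 𝔭bar ∅ γ).map (PowerSeries.map j) ≤
            Ideal.span {L})) :
    SignedTwoVariableInputs → Literature.NumberTheory.EllipticCurves.ModularForms.nonempty_modularParametrizationData → ∀ (W : WeierstrassCurve ℚ) [W.IsElliptic] [W.IsGloballyMinimal] (p : ℕ) [Fact p.Prime], 5 ≤ p → W.HasGoodReductionAtPrime p → W.frobeniusTrace p = 0 → Literature.NumberTheory.EllipticCurves.Rank1Residual.Surj W p → ∀ (K : Type) [Field K] [NumberField K] (ι : PadicAlgCl p ≃+* ℂ) (v vbar : IsDedekindDomain.HeightOneSpectrum (NumberField.RingOfIntegers K)) (κ₁ κ₂ : Literature.NumberTheory.EllipticCurves.ZpExtension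 K p) (γ₁ γ₂ : Field.absoluteGaloisGroup K) [Fact (Literature.NumberTheory.EllipticCurves.ZpExtension.IsTopGeneratorPair κ₁ κ₂ γ₁ γ₂)] [NeZero (NumberField.discr K).natAbs] (N : ℕ) [NeZero N] (f : CuspForm (CongruenceSubgroup.Gamma0 N) 2), Literature.NumberTheory.EllipticCurves.ModularForms.IsNewformOf W f → (N : ℤ) = W.conductorNorm ℤ → Literature.NumberTheory.EllipticCurves.IsImaginaryQuadratic K → ((Ideal.span {(p : ℤ)}).primesOver (NumberField.RingOfIntegers K)).ncard = 2 → ((p : ℕ) : NumberField.RingOfIntegers K) ∈ v.asIdeal → ((p : ℕ) : NumberField.RingOfIntegers K) ∈ vbar.asIdeal → vbar ≠ v → (∀ (w : NumberField.InfinitePlace K) (k : NumberField.RingOfIntegers K), k ∈ v.asIdeal ↔ ‖ι.symm (w.embedding (k : K))‖ < 1) → IsCoprime (N : ℤ) (NumberField.discr K) → (∀ ℓ : ℕ, ℓ.Prime → ℓ ∣ N → ((Ideal.span {(ℓ : ℤ)}).primesOver (NumberField.RingOfIntegers K)).ncard = 2) → Odd (NumberField.discr K) → NumberField.discr K ≠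 -3 → κ₁.IsCyclotomic → κ₂.IsAnticyclotomic → ¬ p ∣ NumberField.classNumber K → ¬ Squarefree N → (∀ q : ℕ, q.Prime → q ∣ N → ∃ v' : IsDedekindDomain.HeightOneSpectrum (NumberField.RingOfIntegers ℚ), ((q : ℕ) : NumberField.RingOfIntegers ℚ) ∈ v'.asIdeal ∧ ∃ 𝔓 ∈ v'.primesAbove, ∃ σ ∈ 𝔓.inertia (Field.absoluteGaloisGroup ℚ), ∃ P : W.geomTorsion (p : ℤ), σ • P ≠ P) → (haveI : Fact (κ₂.IsTopGenerator γ₂) := ⟨Literature.NumberTheory.EllipticCurves.YanZhu2026.isTopGenerator_of_pair (κ₁ := κ₁) (γ₁ := γ₁)⟩; Module.IsTorsion (Literature.NumberTheory.EllipticCurves.IwasawaAlgebra p) (Literature.NumberTheory.EllipticCurves.Castella2018.AcSelmer.XAc (W.baseChange K) p κ₂ vbar ∅ γ₂)) → ∀ (ΩK : ℂ) (Ωp' : (Literature.NumberTheory.EllipticCurves.unrIntegers p)ˣ) (L : Literature.NumberTheory.EllipticCurves.UnrSeries p), ΩK ≠ 0 → Literature.NumberTheory.EllipticCurves.IsBDPLFunction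 ι v κ₂ γ₂ f ΩK ((Ωp' : Literature.NumberTheory.EllipticCurves.unrIntegers p) : PadicComplex p) L → ∀ J : ℤ_[p] →+* PadicComplexInt p, (∀ x : ℤ_[p], ((J x : PadicComplexInt p) : PadicComplex p) = ((x : ℚ_[p]) : PadicComplex p)) → ∀ (J₀ : Literature.NumberTheory.EllipticCurves.unrIntegers p →+* PadicComplexInt p), (∀ x : Literature.NumberTheory.EllipticCurves.unrIntegers p, ((J₀ x : PadicComplexInt p) : PadicComplex p) = (x : PadicComplex p)) → ∃ k : ℕ, ∀ y ∈ (haveI : Fact (κ₂.IsTopGenerator γ₂) := ⟨Literature.NumberTheory.EllipticCurves.YanZhu2026.isTopGenerator_of_pair (κ₁ := κ₁) (γ₁ := γ₁)⟩; Literature.NumberTheory.EllipticCurves.Castella2018.AcSelmer.XAc.charIdeal (W.baseChange K) p κ₂ vbar ∅ γ₂).map (PowerSeries.map J), PowerSeries.C (((p : ℕ) : PadicComplexInt p) ^ k) * y ∈ Ideal.span {PowerSeries.map J₀ L} := by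
  intro hIn hmodP W _ _ p _ hp hgood ha0 hs K _ _ ι v vbar κ₁ κ₂ γ₁ γ₂ _ _ N _ f hf hN hK hsplit hv hvbar hvv hι hcop hHeeg hodd
    hne3 hκ₁ hκ₂ hh hnsq hram htors ΩK Ωp' L hΩK hL J hJ J₀ hJ₀
  haveI hγF : Fact (κ₂.IsTopGenerator γ₂) := ⟨isTopGenerator_of_pair (κ₁ := κ₁) (γ₁ := γ₁)⟩
  have hprime : p.Prime := Fact.out
  have hp2 : p ≠ 2 := by omega
  -- the research stub at `(ι, W, K, v, v̄, κ₂, γ₂, f)`: a Castella–Wan frame and the rational inclusion along `toUnr`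
  obtain ⟨ΩKw, Ωpw, LW, hΩKw, hLW, hk⟩ :=
    hC ι W K v vbar κ₂ γ₂ hf hN hp hgood ha0 hs hK hsplit hv hι hvbar hvv hHeeg hcop hh hodd hne3 hnsq hram hκ₂
  obtain ⟨k, hkle⟩ := hk (toUnr p) (coe_toUnr p)
  -- the structure maps of S1 are the canonical ones (`𝒪_{ℂ_p} ↪ ℂ_p` is injective)
  have hJ₀eq : J₀ = R1.unrToCpInt p :=
    RingHom.ext fun x ↦ Subtype.ext ((hJ₀ x).trans (R1.coe_unrToCpInt p x).symm)
  subst hJ₀eq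
  have hJeq : J = R1.toCpInt p :=
    RingHom.ext fun x ↦ Subtype.ext ((hJ x).trans (R1.coe_toCpInt p x).symm)
  subst hJeq
  -- the two frames generate the same ideal of `𝒪_{ℂ_p}⟦T⟧` (width seat's concordance theorem)
  have hN' : (W.conductorNorm ℤ : ℕ) = N := by exact_mod_cast hN.symm
  have hpN : ¬ p ∣ N := by
    rw [← hN']
    exact not_dvd_conductorNorm_of_hasGoodReductionAtPrime W hgood
  have hpD : ¬ (p : ℤ) ∣ NumberField.discr K :=
    not_dvd_discr_of_ncard_primesOver hprime (by rw [hK.1]; exact hsplit)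
  have hconc : Ideal.span {PowerSeries.map (R1.unrToCpInt p) LW} =
      Ideal.span {PowerSeries.map (R1.unrToCpInt p) L} :=
    SignedBaseChangeAcDivFrameConcordance.span_map_eq_of_isCWBDPLFunction_of_isBDPLFunction hp2 hK hκ₂
      hγF.out hpN hpD hΩKw hΩK (coe_units_unrIntegers_ne_zero Ωpw) (coe_units_unrIntegers_ne_zero Ωp') hLW hL
  -- push the inclusion along `R₀ → 𝒪_{ℂ_p}`
  refine ⟨k, fun y hy ↦ ?_⟩
  have hmap := Ideal.map_mono (f := PowerSeries.map (R1.unrToCpInt p)) hkle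
  rw [Ideal.map_mul, Ideal.map_span, Set.image_singleton, Ideal.map_span, Set.image_singleton, Ideal.map_map,
    ← R1.map_toCpInt_eq_comp, PowerSeries.map_C, map_pow, map_natCast, hconc] at hmap
  exact hmap (Ideal.mul_mem_mul (Ideal.mem_span_singleton_self _) hy)

end Summit.BirchSwinnertonDyer.BirchSwinnertonDyer.Theorems.SignedBaseChangeAcDivAdmdefRamifiedNSDisc

end
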